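import Literature.AlgebraicGeometry.HodgeTheory.LefschetzOneOneChowClosed
import Literature.AlgebraicGeometry.HodgeTheory.HypersurfaceComplexPoints
import Literature.AlgebraicGeometry.Motives.GAGAConeBridgeProofs
import Literature.NumberTheory.Transcendental.AnalytificationUniquenessProofs
import Literature.NumberTheory.Transcendental.AnalytificationProofs
import HarnessLib

/-!
# GAGA §5, second clause: a closed smooth subvariety carries the induced analytic structure (proof)

Family `hodge`, layer `Literature/AlgebraicGeometry/HodgeTheory`. Proof file for the named fact
`exists_mdifferentiableOn_extension_of_isClosedImmersion` of `LefschetzOneOneChow.lean` (Serre,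
GAGA §2 n°5 p. 9: «de plus, la structure analytique de `Y^h` coïncide avec la structure analytique
induite sur `Y` par `X^h`»), which is **discharged here**
(`exists_mdifferentiableOn_extension_of_isClosedImmersion_holds`): for a closed immersion
`g : X ⟶ Y` of smooth `k`-schemes (`k ⊆ ℂ`), analytifications `φ : M → X(ℂ)`, `ψ : M' → Y(ℂ)`
with holomorphic atlases and the induced map `h` (`ψ ∘ h = g(ℂ) ∘ φ`), every `ℂᵐ`-valued
function holomorphic on an open `U ⊆ M` is, near each point of `U`, the pull-back along `h` of a
function holomorphic on an open subset of `M'`.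

## Proof

Serre's definition of `X^h` (n°5 Prop. 2: «toute carte algébrique doit être une carte
analytique») makes this a statement about algebraic charts, and the tree has them:
`Literature.NumberTheory.Transcendental.exists_algebraicChart_holds` gives at `φ x` a chart `e` of
`X(ℂ)` whose coordinates are regular functions `x₁, …, x_d ∈ Γ(X, Uₐ)` on an affine open `Uₐ`, the
charts form a holomorphic atlas (`isManifold_chartedSpaceOfCharts`) for which `id : X(ℂ) → X(ℂ)`
is an analytification, and by uniqueness (`IsAnalytification.unique_holds`, n°5 Prop. 2 «et une
seule») `φ` is a biholomorphism `H : M ≅ X(ℂ)` onto this model. Since `g` is a closed immersion,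
`Uₐ ⊇ g⁻¹(V)` for an affine open `V ∋ g(φ x)` of `Y` (the topology of `X` is induced) and the
coordinates `xᵢ|_{g⁻¹V}` lift to `bᵢ ∈ Γ(Y, V)` (Mathlib `Scheme.Hom.app_surjective`). The
functions `uᵢ = bᵢ ∘ ψ` are holomorphic on `ψ⁻¹(V(ℂ))` (definition of an analytification) and
`u ∘ h = e ∘ φ` near `x` (`bᵢ(g(P)) = (g^* bᵢ)(P) = xᵢ(P)`), so
`ρ := H⁻¹ ∘ e⁻¹ ∘ u : M' ⇢ M` is a holomorphic map, defined near `h x`, with `ρ ∘ h = id` near `x`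
— the local holomorphic retraction onto `Y^h`. The extension of `f` is `F := f ∘ ρ`. To make
`F (h y) = f y` hold for all `y ∈ U` with `h y` in the domain `W` of `F`, `W` is cut down by an
open `W₀` with `h⁻¹(W₀) = U ∩ φ⁻¹(e.source)`, which exists because `h` is a topological embedding:
`g(ℂ) : X(ℂ) → Y(ℂ)` is an embedding for the strong topologies (the tree's
`Motives.AlgPoints.isEmbedding_map_of_isClosedImmersion`, file `HypersurfaceComplexPoints.lean`:
sub-basic opens of `X(ℂ)` are locally preimages of sub-basic opens of `Y(ℂ)` defined by lifts of
regular functions along the closed immersion).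

Finally `chow_analyticSet_analytification_of_isProjAlgebraicSet`: with both §5 clauses proved (the
first in `LefschetzOneOneChowClosed.lean`), `chow_analyticSet_analytification` follows from Chow's
theorem in `ℙᴺ(ℂ)` (`Motives.isProjAlgebraicSet_of_isAnalyticSet`, hodge.S17) alone, and
`chow_analyticSet_analytification_of_cone_form`: through the discharged bridge of
`Motives/GAGAConeBridgeProofs.lean`, from the cone form `Motives.exists_finset_isHomogeneous_of_isCone`
alone — the single deep input left under fact 2 of `lefschetzOneOne_rational`.

## References

* [SerreGAGA1956] J.-P. Serre, Géométrie algébrique et géométrie analytique, Ann. Inst. Fourier 6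
  (1956), §2 n°5: Lemme 1, Prop. 2 (p. 8) and p. 9 (structure induite, fonctorialité).
* [SGA1] A. Grothendieck, M. Raynaud, SGA 1, Exp. XII Thm. 1.1 (proof, a)–b)).
-/

noncomputable section

open scoped Manifold ContDiff Topology
open CategoryTheory AlgebraicGeometry TopologicalSpace
open Literature.AlgebraicGeometry.Motives (AlgPoints ComplexPoints SchemeOver)
open Literature.NumberTheory.Transcendental (IsAnalytification exists_algebraicChart_holds
  chartedSpaceOfCharts isManifold_chartedSpaceOfCharts)
open Literature.Geometry.Kaehler (IsAnalyticSet IsAnalyticSetAt)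

namespace Literature.AlgebraicGeometry.HodgeTheory

section HodgeTheory

/-! ### The discharge -/

section Induced

/-- **Discharge of `exists_mdifferentiableOn_extension_of_isClosedImmersion`** (Serre, GAGA §2
n°5 p. 9: «la structure analytique de `Y^h` coïncide avec la structure analytique induite sur `Y`
par `X^h`», with n°5 Prop. 2 «toute carte algébrique doit être une carte analytique … et une
seule»). See the module docstring: with an algebraic chart `e` of `X(ℂ)` at `φ x`
(`exists_algebraicChart_holds`), the biholomorphism `H : M ≅ X(ℂ)` of uniqueness
(`unique_holds`), lifts `bᵢ ∈ Γ(Y, V)` of the coordinates of `e` along the closed immersion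
(`Scheme.Hom.app_surjective`) and `u = (bᵢ ∘ ψ)ᵢ`, the map `ρ = H⁻¹ ∘ e⁻¹ ∘ u` is a holomorphic
retraction of a neighbourhood of `h x` onto `M` (`ρ ∘ h = id` near `x`), and `F = f ∘ ρ` is the
extension, on an open set cut down by the embedding property of `h`
(`Motives.AlgPoints.isEmbedding_map_of_isClosedImmersion`).
[cite: SerreGAGA1956, §2 n°5 Prop. 2 and p. 9] -/
theorem exists_mdifferentiableOn_extension_of_isClosedImmersion_holds :
    exists_mdifferentiableOn_extension_of_isClosedImmersion := by
  intro k _ _ X Y g _ _ _ E _ _ _ E' _ _ _ M _ _ M' _ _ d e' φ ψ hφ hψ _ _ _ _ h hh U₀ hU₀ m f hf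
    x hx
  classical
  have hhm : ∀ y, ψ (h y) = AlgPoints.map g (φ y) := fun y ↦ congrFun hh y
  -- `h = ψ⁻¹ ∘ g(ℂ) ∘ φ` is a topological embedding
  have hdef : h = fun y ↦ hψ.homeomorph.symm (AlgPoints.map g (φ y)) := by
    funext y
    rw [← hhm y]
    exact (hψ.homeomorph.symm_apply_apply (h y)).symm
  have hind : Topology.IsInducing h := by
    rw [hdef]
    exact hψ.homeomorph.symm.isInducing.comp
      ((Motives.AlgPoints.isEmbedding_map_of_isClosedImmersion g).isInducing.comp
        hφ.homeomorph.isInducing)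
  -- (1) the model analytification `X(ℂ)` with algebraic charts, and `H : M ≅ X(ℂ)`
  choose chart mem alg hol using fun P ↦ exists_algebraicChart_holds X d P
  letI cs : ChartedSpace (Fin d → ℂ) (ComplexPoints X) := chartedSpaceOfCharts chart mem
  haveI hM₀ : IsManifold 𝓘(ℂ, Fin d → ℂ) ω (ComplexPoints X) :=
    isManifold_chartedSpaceOfCharts chart mem alg hol
  have hφ₀ : IsAnalytification (Fin d → ℂ) X d (id : ComplexPoints X → ComplexPoints X) := by
    refine ⟨IsHomeomorph.id, by simp, fun U s P hP ↦ ?_⟩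
    simp only [Set.preimage_id_eq, id_eq, Set.mem_setOf_eq] at hP
    refine MDifferentiableAt.mdifferentiableWithinAt ?_
    rw [mdifferentiableAt_iff]
    refine ⟨(AlgPoints.continuousOn_evalOrZero _ s).continuousAt
      ((AlgPoints.isOpen_setOf_pt_mem _).mem_nhds hP), ?_⟩
    simp only [writtenInExtChartAt, extChartAt, OpenPartialHomeomorph.extend,
      modelWithCornersSelf_partialEquiv, PartialEquiv.trans_refl, modelWithCornersSelf_coe,
      Set.range_id, OpenPartialHomeomorph.toFun_eq_coe,
      OpenPartialHomeomorph.coe_toPartialEquiv_symm]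
    refine DifferentiableAt.differentiableWithinAt ?_
    have hopen : IsOpen ((chart P).target ∩ (chart P).symm ⁻¹' {Q | Q.pt ∈ (↑U : X.left.Opens)}) :=
      (chart P).isOpen_inter_preimage_symm (AlgPoints.isOpen_setOf_pt_mem _)
    have hmem : chart P P ∈ (chart P).target ∩ (chart P).symm ⁻¹' {Q | Q.pt ∈ (↑U : X.left.Opens)} :=
      ⟨(chart P).map_source (mem P), by
        simp only [Set.mem_preimage, Set.mem_setOf_eq, (chart P).left_inv (mem P)]; exact hP⟩
    exact ((hol P U s).differentiableOn (by simp)).differentiableAt (hopen.mem_nhds hmem)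
  obtain ⟨H, -, hHsymm, hHφ⟩ :=
    Literature.NumberTheory.Transcendental.IsAnalytification.unique_holds hφ hφ₀
  have hHφ' : ∀ y, H y = φ y := fun y ↦ congrFun hHφ y
  -- (2) the algebraic chart `ex` at `φ x`, its coordinates, and an affine open `V` of `Y`
  obtain ⟨Ua, xc, hsrc, hxc⟩ := alg (φ x)
  obtain ⟨U', hU', hUU'⟩ := g.left.isClosedEmbedding.isInducing.isOpen_iff.mp Ua.1.isOpen
  have hxUa : (φ x).pt ∈ (Ua : X.left.Opens) := hsrc (mem (φ x))
  have hgx : g.left (φ x).pt ∈ U' := by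
    rw [← Set.mem_preimage, hUU']
    exact hxUa
  obtain ⟨_, ⟨V, hV, rfl⟩, hxV, hVU'⟩ :=
    Y.left.isBasis_affineOpens.exists_subset_of_mem_open hgx hU'
  have hle : g.left ⁻¹ᵁ V ≤ (Ua : X.left.Opens) := by
    intro z hz
    change z ∈ ((Ua : X.left.Opens) : Set X.left)
    rw [← hUU']
    exact hVU' hz
  -- (3) lifts `b i ∈ Γ(Y, V)` of the coordinates and the holomorphic map `u = (bᵢ ∘ ψ)ᵢ`
  choose b hb using fun i ↦ g.left.app_surjective V hV (X.left.presheaf.map (homOfLE hle).op (xc i))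
  obtain ⟨u, hudef⟩ : ∃ u : M' → (Fin d → ℂ), u = fun p i ↦ AlgPoints.evalOrZero V (b i) (ψ p) :=
    ⟨_, rfl⟩
  have hA : IsOpen (ψ ⁻¹' {Q | Q.pt ∈ V}) := hψ.isOpen_preimage V
  have hu : MDifferentiableOn 𝓘(ℂ, E') 𝓘(ℂ, Fin d → ℂ) u (ψ ⁻¹' {Q | Q.pt ∈ V}) := by
    rw [hudef]
    exact Literature.Geometry.Kaehler.mdifferentiableOn_pi_space.2
      fun i ↦ hψ.mdifferentiableOn_evalOrZero ⟨V, hV⟩ (b i)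
  -- `u ∘ h = e ∘ φ` on `φ⁻¹(e.source ∩ g⁻¹V(ℂ))`
  have huh : ∀ y, (φ y).pt ∈ g.left ⁻¹ᵁ V → φ y ∈ (chart (φ x)).source →
      u (h y) = chart (φ x) (φ y) := by
    intro y hyV hysrc
    funext i
    rw [hudef, hxc _ hysrc i]
    change AlgPoints.evalOrZero V (b i) (ψ (h y)) = _
    rw [hhm, AlgPoints.evalOrZero_map, hb i, AlgPoints.evalOrZero_map_homOfLE hle _ hyV]
  -- (4) the retraction `ρ = H⁻¹ ∘ e⁻¹ ∘ u` and its domain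
  obtain ⟨ρ, hρdef⟩ : ∃ ρ : M' → M, ρ = fun p ↦ H.symm ((chart (φ x)).symm (u p)) := ⟨_, rfl⟩
  have hD : IsOpen (ψ ⁻¹' {Q | Q.pt ∈ V} ∩ u ⁻¹' (chart (φ x)).target) :=
    hu.continuousOn.isOpen_inter_preimage hA (chart (φ x)).open_target
  have hρcont : ContinuousOn ρ (ψ ⁻¹' {Q | Q.pt ∈ V} ∩ u ⁻¹' (chart (φ x)).target) := by
    rw [hρdef]
    refine H.symm.continuous.comp_continuousOn ((chart (φ x)).continuousOn_symm.comp
      (hu.continuousOn.mono Set.inter_subset_left) fun p hp ↦ hp.2)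
  have hρdiff : MDifferentiableOn 𝓘(ℂ, E') 𝓘(ℂ, E) ρ
      (ψ ⁻¹' {Q | Q.pt ∈ V} ∩ u ⁻¹' (chart (φ x)).target) := by
    rw [hρdef]
    refine hHsymm.comp_mdifferentiableOn ?_
    exact (mdifferentiableOn_atlas_symm (I := 𝓘(ℂ, Fin d → ℂ))
      (chart_mem_atlas (Fin d → ℂ) (φ x))).comp (hu.mono Set.inter_subset_left) fun p hp ↦ hp.2
  have hρh : ∀ y, (φ y).pt ∈ g.left ⁻¹ᵁ V → φ y ∈ (chart (φ x)).source → ρ (h y) = y := by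
    intro y hyV hysrc
    rw [hρdef]
    change H.symm ((chart (φ x)).symm (u (h y))) = y
    rw [huh y hyV hysrc, (chart (φ x)).left_inv hysrc, ← hHφ' y, Homeomorph.symm_apply_apply]
  -- (5) an open `W₀` of `M'` with `h⁻¹(W₀) = U₀ ∩ φ⁻¹(e.source)` (embedding property)
  obtain ⟨W₀, hW₀, hW₀eq⟩ := hind.isOpen_iff.mp
    (hU₀.inter ((chart (φ x)).open_source.preimage hφ.isHomeomorph.continuous))
  -- (6) the open set `W` and the extension `F = f ∘ ρ`
  have hW : IsOpen (W₀ ∩ (ψ ⁻¹' {Q | Q.pt ∈ V} ∩ u ⁻¹' (chart (φ x)).target ∩ ρ ⁻¹' U₀)) :=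
    hW₀.inter (hρcont.isOpen_inter_preimage hD hU₀)
  have hxsrc : φ x ∈ (chart (φ x)).source := mem (φ x)
  have hxV' : (φ x).pt ∈ g.left ⁻¹ᵁ V := hxV
  refine ⟨W₀ ∩ (ψ ⁻¹' {Q | Q.pt ∈ V} ∩ u ⁻¹' (chart (φ x)).target ∩ ρ ⁻¹' U₀), hW,
    ⟨?_, ⟨?_, ?_⟩, ?_⟩, f ∘ ρ, ?_, ?_⟩
  · -- `h x ∈ W₀`
    rw [← Set.mem_preimage, hW₀eq]
    exact ⟨hx, hxsrc⟩
  · -- `ψ (h x) ∈ V(ℂ)`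
    change (ψ (h x)).pt ∈ V
    rw [hhm]
    exact hxV
  · -- `u (h x) ∈ e.target`
    rw [Set.mem_preimage, huh x hxV' hxsrc]
    exact (chart (φ x)).map_source hxsrc
  · -- `ρ (h x) ∈ U₀`
    rw [Set.mem_preimage, hρh x hxV' hxsrc]
    exact hx
  · -- `F` is holomorphic on `W`
    have hρW : MDifferentiableOn 𝓘(ℂ, E') 𝓘(ℂ, E) ρ
        (W₀ ∩ (ψ ⁻¹' {Q | Q.pt ∈ V} ∩ u ⁻¹' (chart (φ x)).target ∩ ρ ⁻¹' U₀)) :=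
      hρdiff.mono fun p hp ↦ hp.2.1
    exact hf.comp hρW fun p hp ↦ hp.2.2
  · -- `F (h y) = f y` for `y ∈ U₀` with `h y ∈ W`
    rintro y - ⟨hyW₀, ⟨⟨hyV, -⟩, -⟩⟩
    have hy : y ∈ U₀ ∩ φ ⁻¹' (chart (φ x)).source := by
      rw [← hW₀eq]
      exact hyW₀
    have hyV' : (φ y).pt ∈ g.left ⁻¹ᵁ V := by
      change (AlgPoints.map g (φ y)).pt ∈ V
      rw [← hhm]
      exact hyV
    change f (ρ (h y)) = f y
    rw [hρh y hyV' hy.2]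

end Induced

/-! ### `chow_analyticSet_analytification` from Chow's theorem in `ℙᴺ(ℂ)` alone -/

/-- **Chow's theorem for analytifications of smooth projective varieties, from Chow's theorem in
projective space.** With both clauses of GAGA §2 n°5 p. 9 proved
(`isAnalyticSet_preimage_range_map_of_isClosedImmersion_holds`,
`exists_mdifferentiableOn_extension_of_isClosedImmersion_holds`), the named fact
`chow_analyticSet_analytification` of `LefschetzOneOneProofs.lean` (Serre, GAGA §19 Prop. 13 for
an analytification of a smooth projective `X`; fact 2 of `lefschetzOneOne_rational`) follows from
Chow's theorem in the projective spaces `ℙᴺ(ℂ)` alone — the tree's named fact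
`Motives.isProjAlgebraicSet_of_isAnalyticSet` (hodge.S17), its only remaining input.
[cite: SerreGAGA1956, §19 Prop. 13 and §2 n°5 p. 9] [cite: Chow1949, Thm. V] -/
theorem chow_analyticSet_analytification_of_isProjAlgebraicSet
    (hChow : ∀ N : ℕ, Motives.isProjAlgebraicSet_of_isAnalyticSet (n := N)) :
    chow_analyticSet_analytification :=
  chow_analyticSet_analytification_of hChow
    isAnalyticSet_preimage_range_map_of_isClosedImmersion_holds
    exists_mdifferentiableOn_extension_of_isClosedImmersion_holds

/-- **Chow's theorem for analytifications of smooth projective varieties, from the cone form of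
Chow's theorem.** Composing with the discharged analytic bridge between `ℙᴺ(ℂ)` and affine cones
(`Motives.isProjAlgebraicSet_of_isAnalyticSet_of_cone_form'`, file
`Motives/GAGAConeBridgeProofs.lean`), the only remaining input of `chow_analyticSet_analytification`
is the cone form of Chow's theorem in every `ℂᴺ⁺¹` — the named fact
`Motives.exists_finset_isHomogeneous_of_isCone` of `Motives/ChowTheorem.lean` (hodge.S17 in cone form: a
closed cone analytic off the vertex is cut out by finitely many homogeneous polynomials; its
content is the Remmert–Stein extension across the vertex, equivalently Serre's GAGA §19 Prop. 13).
[cite: SerreGAGA1956, §19 Prop. 13 and §2 n°5 p. 9] [cite: Chow1949, Thm. V] -/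
theorem chow_analyticSet_analytification_of_cone_form
    (hcone : ∀ N : ℕ, Motives.exists_finset_isHomogeneous_of_isCone (n := N)) :
    chow_analyticSet_analytification :=
  chow_analyticSet_analytification_of_isProjAlgebraicSet fun N ↦
    Motives.isProjAlgebraicSet_of_isAnalyticSet_of_cone_form' (hcone N)

end HodgeTheory

end Literature.AlgebraicGeometry.HodgeTheory

end
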